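import Mathlib
import HarnessLib
import Summits.NavierStokesRegularity.NavierStokesRegularity.Theorems.PoloidalWindowDoorLrcModEntireTwistingTHOscSimilarityTransform

/-!
# Item `LrcModEntire` (stmt-NavierStokesRegularity-20428), skeleton twist_split v6, CLASS road to `stub_twistingTHGerm` —
# (h2-b) the OBJECT TRANSFER `(t,z) → (τ,ξ)`: a physical-variable plane-oscillation object obeying (OSC) with Type-I / scale-invariant bounds yields
# the analytic conjuncts of the similarity-(OSC) hypothesis object of `…TwistingTHOscRoad.eq_zero_of_similarityOsc`

Cell ns-regularity-ideate, seat ns-k2-port-2 g3 (`--supports stmt-NavierStokesRegularity-20428 --as helper`; division of labour with the LEAD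
ns-poloidal-K2-p3 g13, STATUS 2026-08-29T01:50:46Z: port-2 owns (h2), the LEAD supplies the LINK conjunct (h2-c)).  INPUT (in `(t,z)`, `t < 0`): `O, S : ℝ → ℝ → ℝ`
with `uncurry O` Fréchet-differentiable (`Od t z`, time component continuous in `z`), `O(t,·) ∈ C²`, `S(t,·) ∈ C¹`; (OSC) pointwise
`∂ₜO + ½∂_z(S·O) − ∂_zzO ≤ 0`; the Type-I dictionary `0 ≤ O`, `√(−t)·O ≤ c`, `√(−t)|S| ≤ A`; and the scale-invariant polynomial bounds
`(−t)^{3/2}|∂ₜO|, (−t)|∂_zO|, (−t)^{3/2}|∂_zzO|, (−t)|∂_zS| ≤ K(1 + z²/(−t))^k`.  OUTPUT (`simObject_of_planeObject`): for `Q := simQ O`, `Ŝ := simQ S`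
(`…TwistingTHOscSimilarityDefs`) there is `Qt` with conjuncts 2–13 of the hypothesis object (`Q(τ,·) ∈ C²`, `HasDerivAt` in `τ`, `Qt(τ,·)` continuous,
`0 ≤ Q ≤ c`, `|Qt|, |Q_ξ|, |Q_ξξ|, |Ŝ_ξ| ≤ K′(1+ξ²)^{k+1}`, `Ŝ(τ,·) ∈ C¹`, `|Ŝ| ≤ A`, and `Qt + ½∂_ξ((ξ+Ŝ)Q) ≤ Q_ξξ`), with `K′ = 2K + c`.
So (h2) for the class road shrinks to: «the true plane envelopes of the Clebsch weight (or `C²` majorants/minorants of them) satisfy the INPUT list».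

WHAT THIS IS NOT: not a claim about Navier–Stokes regularity and not the stub — calculus/bookkeeping (bears_on LADDER-NS N0, item 20428 / crux 19708).
-/

noncomputable section

-- the summit and its single sub-problem share the name (CONVENTIONS §1), as in every Theorems file
set_option linter.dupNamespace false

namespace Summit.NavierStokesRegularity.NavierStokesRegularity.Theorems.PoloidalWindowDoorLrcModEntireTwistingTHOscSimilarityObject

open Set Filter Topology
open Summit.NavierStokesRegularity.NavierStokesRegularity.Theorems.PoloidalWindowDoorLrcModEntireTwistingTHOscSimilarityDefs
open Summit.NavierStokesRegularity.NavierStokesRegularity.Theorems.PoloidalWindowDoorLrcModEntireTwistingTHOscSimilarityTransform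

variable {O S : ℝ → ℝ → ℝ} {Od : ℝ → ℝ → (ℝ × ℝ →L[ℝ] ℝ)} {A c K : ℝ} {k : ℕ}

/-- `(ξσ)²/σ² = ξ²`, i.e. `z²/(−t) = ξ²` at corresponding points. -/
theorem sim_ratio (τ ξ : ℝ) : 1 + (ξ * sig τ) ^ 2 / (-tim τ) = 1 + ξ ^ 2 := by
  rw [← sig_sq]
  have h := (sig_pos τ).ne'
  field_simp

/-- `√(−t) = σ` at `t = tim τ`. -/
theorem sqrt_neg_tim (τ : ℝ) : Real.sqrt (-tim τ) = sig τ := by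
  rw [← sig_sq, Real.sqrt_sq (sig_pos τ).le]

/-- **(h2-b) THE OBJECT TRANSFER.**  See the module docstring for INPUT/OUTPUT.  The produced time derivative is
`Qt τ ξ = σ³·∂ₜO − ½σ·O − ½ξσ²·∂_zO` at `(t,z) = (tim τ, ξ·sig τ)`. -/
theorem simObject_of_planeObject
    (hOF : ∀ t < 0, ∀ z, HasFDerivAt (Function.uncurry O) (Od t z) (t, z))
    (hOtc : ∀ t < 0, Continuous fun z => Od t z (1, 0))
    (hO2 : ∀ t < 0, ContDiff ℝ 2 (O t)) (hS1 : ∀ t < 0, ContDiff ℝ 1 (S t))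
    (hosc : ∀ t < 0, ∀ z, Od t z (1, 0) + (1 / 2 : ℝ) * deriv (fun z => S t z * O t z) z - deriv (deriv (O t)) z ≤ 0)
    (h0 : ∀ t < 0, ∀ z, 0 ≤ O t z) (hc : ∀ t < 0, ∀ z, Real.sqrt (-t) * O t z ≤ c)
    (hSA : ∀ t < 0, ∀ z, Real.sqrt (-t) * |S t z| ≤ A)
    (hOt : ∀ t < 0, ∀ z, Real.sqrt (-t) * (-t) * |Od t z (1, 0)| ≤ K * (1 + z ^ 2 / (-t)) ^ k)
    (hOz : ∀ t < 0, ∀ z, (-t) * |deriv (O t) z| ≤ K * (1 + z ^ 2 / (-t)) ^ k)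
    (hOzz : ∀ t < 0, ∀ z, Real.sqrt (-t) * (-t) * |deriv (deriv (O t)) z| ≤ K * (1 + z ^ 2 / (-t)) ^ k)
    (hSz : ∀ t < 0, ∀ z, (-t) * |deriv (S t) z| ≤ K * (1 + z ^ 2 / (-t)) ^ k) :
    ∃ Qt : ℝ → ℝ → ℝ,
      (∀ τ, ContDiff ℝ 2 (simQ O τ)) ∧ (∀ τ ξ, HasDerivAt (fun τ' => simQ O τ' ξ) (Qt τ ξ) τ) ∧ (∀ τ, Continuous (Qt τ)) ∧
      (∀ τ ξ, 0 ≤ simQ O τ ξ) ∧ (∀ τ ξ, simQ O τ ξ ≤ c) ∧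
      (∀ τ ξ, |Qt τ ξ| ≤ (2 * K + c) * (1 + ξ ^ 2) ^ (k + 1)) ∧
      (∀ τ ξ, |deriv (simQ O τ) ξ| ≤ (2 * K + c) * (1 + ξ ^ 2) ^ (k + 1)) ∧
      (∀ τ ξ, |deriv (deriv (simQ O τ)) ξ| ≤ (2 * K + c) * (1 + ξ ^ 2) ^ (k + 1)) ∧
      (∀ τ, ContDiff ℝ 1 (simQ S τ)) ∧ (∀ τ ξ, |simQ S τ ξ| ≤ A) ∧
      (∀ τ ξ, |deriv (simQ S τ) ξ| ≤ (2 * K + c) * (1 + ξ ^ 2) ^ (k + 1)) ∧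
      (∀ τ ξ, Qt τ ξ + (1 / 2 : ℝ) * deriv (fun ξ' => (ξ' + simQ S τ ξ') * simQ O τ ξ') ξ ≤ deriv (deriv (simQ O τ)) ξ) := by
  -- the time derivative, with `L(0,1)` written as the slice derivative
  set Qt : ℝ → ℝ → ℝ := fun τ ξ => sig τ ^ 3 * Od (tim τ) (ξ * sig τ) (1, 0)
    - (1 / 2 : ℝ) * sig τ * O (tim τ) (ξ * sig τ) - (1 / 2 : ℝ) * ξ * sig τ ^ 2 * deriv (O (tim τ)) (ξ * sig τ) with hQt
  -- constants are non-negative (from the bounds at one point)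
  have hK0 : 0 ≤ K := by
    have h := hOz (-1) (by norm_num) 0
    have h1 : 0 ≤ (-(-1:ℝ)) * |deriv (O (-1)) 0| := by positivity
    have h2 : (0:ℝ) < (1 + (0:ℝ) ^ 2 / (-(-1:ℝ))) ^ k := by positivity
    nlinarith
  have hc0 : 0 ≤ c := by
    have h := hc (-1) (by norm_num) 0
    have h1 : 0 ≤ Real.sqrt (-(-1:ℝ)) * O (-1) 0 := mul_nonneg (Real.sqrt_nonneg _) (h0 _ (by norm_num) _)
    linarith
  -- regularity facts at time `tim τ`
  have hOd : ∀ τ, Differentiable ℝ (O (tim τ)) := fun τ => (hO2 _ (tim_neg τ)).differentiable (by norm_num)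
  have hO1 : ∀ τ, ContDiff ℝ 1 (deriv (O (tim τ))) := fun τ => by
    have h2 : ContDiff ℝ (1 + 1) (O (tim τ)) := by rw [one_add_one_eq_two]; exact hO2 _ (tim_neg τ)
    exact h2.deriv'
  have hO2d : ∀ τ, Differentiable ℝ (deriv (O (tim τ))) := fun τ => (hO1 τ).differentiable (by norm_num)
  have hSd : ∀ τ, Differentiable ℝ (S (tim τ)) := fun τ => (hS1 _ (tim_neg τ)).differentiable (by norm_num)
  have hslice : ∀ τ ξ, Od (tim τ) (ξ * sig τ) (0, 1) = deriv (O (tim τ)) (ξ * sig τ) :=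
    fun τ ξ => ((deriv_slice_eq (hOF _ (tim_neg τ) (ξ * sig τ))).deriv).symm
  have hlin : ∀ τ, ContDiff ℝ 2 (fun ξ : ℝ => ξ * sig τ) := fun τ => contDiff_id.mul contDiff_const
  refine ⟨Qt, ?_, ?_, ?_, ?_, ?_, ?_, ?_, ?_, ?_, ?_, ?_, ?_⟩
  · -- `Q(τ,·) ∈ C²`
    intro τ
    show ContDiff ℝ 2 (fun ξ => sig τ * O (tim τ) (ξ * sig τ))
    exact contDiff_const.mul ((hO2 _ (tim_neg τ)).comp (hlin τ))
  · -- time derivative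
    intro τ ξ
    have h := hasDerivAt_simQ_time (hOF _ (tim_neg τ) (ξ * sig τ))
    rw [hslice] at h
    simpa [hQt] using h
  · -- continuity of `Qt(τ,·)`
    intro τ
    have h1 : Continuous fun ξ : ℝ => Od (tim τ) (ξ * sig τ) (1, 0) :=
      (hOtc _ (tim_neg τ)).comp (continuous_id.mul continuous_const)
    have h2 : Continuous fun ξ : ℝ => O (tim τ) (ξ * sig τ) := (hOd τ).continuous.comp (continuous_id.mul continuous_const)
    have h3 : Continuous fun ξ : ℝ => deriv (O (tim τ)) (ξ * sig τ) :=
      (hO2d τ).continuous.comp (continuous_id.mul continuous_const)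
    simp only [hQt]
    exact ((continuous_const.mul h1).sub (continuous_const.mul h2)).sub
      (((continuous_const.mul continuous_id).mul continuous_const).mul h3)
  · -- `0 ≤ Q`
    exact (simQ_nonneg_iff (O := O)).2 h0
  · -- `Q ≤ c`
    intro τ ξ
    have h := hc _ (tim_neg τ) (ξ * sig τ)
    rw [sqrt_neg_tim] at h
    exact h
  · -- `|Qt| ≤ K′(1+ξ²)^{k+1}`
    intro τ ξ
    have ht := tim_neg τ
    have hσ := sig_pos τ
    have hP : (1 + (ξ * sig τ) ^ 2 / (-tim τ)) = 1 + ξ ^ 2 := sim_ratio τ ξ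
    have b1 : sig τ ^ 3 * |Od (tim τ) (ξ * sig τ) (1, 0)| ≤ K * (1 + ξ ^ 2) ^ k := by
      have h := hOt _ ht (ξ * sig τ)
      rw [sqrt_neg_tim, hP, ← sig_sq] at h
      calc sig τ ^ 3 * |Od (tim τ) (ξ * sig τ) (1, 0)| = sig τ * sig τ ^ 2 * |Od (tim τ) (ξ * sig τ) (1, 0)| := by ring
        _ ≤ K * (1 + ξ ^ 2) ^ k := h
    have b2 : sig τ * O (tim τ) (ξ * sig τ) ≤ c := by have h := hc _ ht (ξ * sig τ); rwa [sqrt_neg_tim] at h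
    have b2' : 0 ≤ sig τ * O (tim τ) (ξ * sig τ) := mul_nonneg hσ.le (h0 _ ht _)
    have b3 : sig τ ^ 2 * |deriv (O (tim τ)) (ξ * sig τ)| ≤ K * (1 + ξ ^ 2) ^ k := by
      have h := hOz _ ht (ξ * sig τ)
      rwa [hP, ← sig_sq] at h
    have hP1 : 1 ≤ (1 + ξ ^ 2) ^ k := one_le_pow₀ (by nlinarith [sq_nonneg ξ])
    have hPk : (1 + ξ ^ 2) ^ k ≤ (1 + ξ ^ 2) ^ (k + 1) := pow_le_pow_right₀ (by nlinarith [sq_nonneg ξ]) (Nat.le_succ k)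
    have hξ : |ξ| * (1 + ξ ^ 2) ^ k ≤ (1 + ξ ^ 2) ^ (k + 1) := by
      have hle : |ξ| ≤ 1 + ξ ^ 2 := by
        rcases le_or_gt |ξ| 1 with h | h
        · nlinarith [sq_nonneg ξ]
        · have : |ξ| ≤ ξ ^ 2 := by rw [← sq_abs]; nlinarith
          linarith
      calc |ξ| * (1 + ξ ^ 2) ^ k ≤ (1 + ξ ^ 2) * (1 + ξ ^ 2) ^ k :=
            mul_le_mul_of_nonneg_right hle (pow_nonneg (show (0:ℝ) ≤ 1 + ξ ^ 2 by positivity) k)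
        _ = (1 + ξ ^ 2) ^ (k + 1) := by ring
    have t1 : |sig τ ^ 3 * Od (tim τ) (ξ * sig τ) (1, 0)| ≤ K * (1 + ξ ^ 2) ^ k := by
      rw [abs_mul, abs_of_pos (pow_pos hσ 3)]; exact b1
    have t2 : |(1 / 2 : ℝ) * sig τ * O (tim τ) (ξ * sig τ)| ≤ c / 2 := by
      rw [mul_assoc, abs_mul, abs_of_pos (by norm_num : (0:ℝ) < 1 / 2), abs_of_nonneg b2']; linarith
    have t3 : |(1 / 2 : ℝ) * ξ * sig τ ^ 2 * deriv (O (tim τ)) (ξ * sig τ)| ≤ (1 / 2 : ℝ) * |ξ| * (K * (1 + ξ ^ 2) ^ k) := by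
      have e : (1 / 2 : ℝ) * ξ * sig τ ^ 2 * deriv (O (tim τ)) (ξ * sig τ) =
          ((1 / 2 : ℝ) * ξ) * (sig τ ^ 2 * deriv (O (tim τ)) (ξ * sig τ)) := by ring
      rw [e, abs_mul, abs_mul, abs_of_pos (by norm_num : (0:ℝ) < 1 / 2), abs_mul, abs_of_pos (pow_pos hσ 2)]
      exact mul_le_mul_of_nonneg_left b3 (by positivity)
    have tri : |Qt τ ξ| ≤ |sig τ ^ 3 * Od (tim τ) (ξ * sig τ) (1, 0)| + |(1 / 2 : ℝ) * sig τ * O (tim τ) (ξ * sig τ)|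
        + |(1 / 2 : ℝ) * ξ * sig τ ^ 2 * deriv (O (tim τ)) (ξ * sig τ)| := by
      simp only [hQt]
      exact (abs_sub _ _).trans (add_le_add (abs_sub _ _) le_rfl)
    calc |Qt τ ξ| ≤ _ := tri
      _ ≤ K * (1 + ξ ^ 2) ^ k + c / 2 + (1 / 2 : ℝ) * |ξ| * (K * (1 + ξ ^ 2) ^ k) := by linarith
      _ ≤ (2 * K + c) * (1 + ξ ^ 2) ^ (k + 1) := by
          nlinarith [mul_nonneg hK0 (sub_nonneg.2 hPk), mul_nonneg hc0 (sub_nonneg.2 (hP1.trans hPk)),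
            mul_nonneg hK0 (sub_nonneg.2 hξ), mul_nonneg hK0 (pow_nonneg (show (0:ℝ) ≤ 1 + ξ ^ 2 by positivity) (k + 1)),
            abs_nonneg ξ, mul_nonneg (abs_nonneg ξ) (pow_nonneg (show (0:ℝ) ≤ 1 + ξ ^ 2 by positivity) k)]
  · -- `|Q_ξ| ≤ K′(1+ξ²)^{k+1}`
    intro τ ξ
    have ht := tim_neg τ
    rw [deriv_simQ_xi (hOd τ)]
    have h := hOz _ ht (ξ * sig τ)
    rw [sim_ratio, ← sig_sq] at h
    have hPk : (1 + ξ ^ 2) ^ k ≤ (1 + ξ ^ 2) ^ (k + 1) := pow_le_pow_right₀ (by nlinarith [sq_nonneg ξ]) (Nat.le_succ k)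
    rw [abs_mul, abs_of_pos (pow_pos (sig_pos τ) 2)]
    nlinarith [mul_nonneg hK0 (sub_nonneg.2 hPk), mul_nonneg hc0 (pow_nonneg (show (0:ℝ) ≤ 1 + ξ ^ 2 by positivity) (k + 1)),
      mul_nonneg hK0 (pow_nonneg (show (0:ℝ) ≤ 1 + ξ ^ 2 by positivity) (k + 1))]
  · -- `|Q_ξξ| ≤ K′(1+ξ²)^{k+1}`
    intro τ ξ
    have ht := tim_neg τ
    rw [deriv_deriv_simQ_xi (hOd τ) (hO2d τ)]
    have h := hOzz _ ht (ξ * sig τ)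
    rw [sqrt_neg_tim, sim_ratio, ← sig_sq] at h
    have hPk : (1 + ξ ^ 2) ^ k ≤ (1 + ξ ^ 2) ^ (k + 1) := pow_le_pow_right₀ (by nlinarith [sq_nonneg ξ]) (Nat.le_succ k)
    rw [abs_mul, abs_of_pos (pow_pos (sig_pos τ) 3)]
    have e : sig τ ^ 3 = sig τ * sig τ ^ 2 := by ring
    rw [e]
    nlinarith [mul_nonneg hK0 (sub_nonneg.2 hPk), mul_nonneg hc0 (pow_nonneg (show (0:ℝ) ≤ 1 + ξ ^ 2 by positivity) (k + 1)),
      mul_nonneg hK0 (pow_nonneg (show (0:ℝ) ≤ 1 + ξ ^ 2 by positivity) (k + 1))]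
  · -- `Ŝ(τ,·) ∈ C¹`
    intro τ
    show ContDiff ℝ 1 (fun ξ => sig τ * S (tim τ) (ξ * sig τ))
    exact contDiff_const.mul ((hS1 _ (tim_neg τ)).comp ((hlin τ).of_le (by norm_num)))
  · -- `|Ŝ| ≤ A`
    intro τ ξ
    have h := hSA _ (tim_neg τ) (ξ * sig τ)
    rw [sqrt_neg_tim] at h
    show |sig τ * S (tim τ) (ξ * sig τ)| ≤ A
    rwa [abs_mul, abs_of_pos (sig_pos τ)]
  · -- `|Ŝ_ξ| ≤ K′(1+ξ²)^{k+1}`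
    intro τ ξ
    have ht := tim_neg τ
    rw [deriv_simQ_xi (hSd τ)]
    have h := hSz _ ht (ξ * sig τ)
    rw [sim_ratio, ← sig_sq] at h
    have hPk : (1 + ξ ^ 2) ^ k ≤ (1 + ξ ^ 2) ^ (k + 1) := pow_le_pow_right₀ (by nlinarith [sq_nonneg ξ]) (Nat.le_succ k)
    rw [abs_mul, abs_of_pos (pow_pos (sig_pos τ) 2)]
    nlinarith [mul_nonneg hK0 (sub_nonneg.2 hPk), mul_nonneg hc0 (pow_nonneg (show (0:ℝ) ≤ 1 + ξ ^ 2 by positivity) (k + 1)),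
      mul_nonneg hK0 (pow_nonneg (show (0:ℝ) ≤ 1 + ξ ^ 2 by positivity) (k + 1))]
  · -- the similarity form of (OSC)
    intro τ ξ
    have hO2all : ∀ t < 0, Differentiable ℝ (deriv (O t)) := fun t ht => by
      have h2 : ContDiff ℝ (1 + 1) (O t) := by rw [one_add_one_eq_two]; exact hO2 t ht
      exact h2.deriv'.differentiable (by norm_num)
    have hSall : ∀ t < 0, Differentiable ℝ (S t) := fun t ht => (hS1 t ht).differentiable (by norm_num)
    have h := sim_subsolution_of_osc (S := S) hOF hO2all hSall hosc τ ξ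
    rw [hslice] at h
    simpa [hQt] using h


/-- **(h2-b′) THE OBJECT TRANSFER WITH POLYNOMIAL GROWTH** (for the (h1-seq)/majorant Liouville corollaries of
`…TwistingTHOscAncientLiouvilleDecay`): the size hypothesis `√(−t)·O ≤ c` is replaced by the scale-invariant polynomial growth
`√(−t)·O(t,z) ≤ C(1 + z²/(−t))^k`; the output then carries `|Q| ≤ K′(1+ξ²)^{k+1}` instead of `Q ≤ c` (same `K′ = 2K + C`). -/
theorem simObject_of_planeObject_poly {C : ℝ}
    (hOF : ∀ t < 0, ∀ z, HasFDerivAt (Function.uncurry O) (Od t z) (t, z))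
    (hOtc : ∀ t < 0, Continuous fun z => Od t z (1, 0))
    (hO2 : ∀ t < 0, ContDiff ℝ 2 (O t)) (hS1 : ∀ t < 0, ContDiff ℝ 1 (S t))
    (hosc : ∀ t < 0, ∀ z, Od t z (1, 0) + (1 / 2 : ℝ) * deriv (fun z => S t z * O t z) z - deriv (deriv (O t)) z ≤ 0)
    (h0 : ∀ t < 0, ∀ z, 0 ≤ O t z) (hOb : ∀ t < 0, ∀ z, Real.sqrt (-t) * O t z ≤ C * (1 + z ^ 2 / (-t)) ^ k)
    (hC : 0 ≤ C) (hSA : ∀ t < 0, ∀ z, Real.sqrt (-t) * |S t z| ≤ A)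
    (hOt : ∀ t < 0, ∀ z, Real.sqrt (-t) * (-t) * |Od t z (1, 0)| ≤ K * (1 + z ^ 2 / (-t)) ^ k)
    (hOz : ∀ t < 0, ∀ z, (-t) * |deriv (O t) z| ≤ K * (1 + z ^ 2 / (-t)) ^ k)
    (hOzz : ∀ t < 0, ∀ z, Real.sqrt (-t) * (-t) * |deriv (deriv (O t)) z| ≤ K * (1 + z ^ 2 / (-t)) ^ k)
    (hSz : ∀ t < 0, ∀ z, (-t) * |deriv (S t) z| ≤ K * (1 + z ^ 2 / (-t)) ^ k) :
    ∃ Qt : ℝ → ℝ → ℝ,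
      (∀ τ, ContDiff ℝ 2 (simQ O τ)) ∧ (∀ τ ξ, HasDerivAt (fun τ' => simQ O τ' ξ) (Qt τ ξ) τ) ∧ (∀ τ, Continuous (Qt τ)) ∧
      (∀ τ ξ, 0 ≤ simQ O τ ξ) ∧ (∀ τ ξ, |simQ O τ ξ| ≤ (2 * K + C) * (1 + ξ ^ 2) ^ (k + 1)) ∧
      (∀ τ ξ, |Qt τ ξ| ≤ (2 * K + C) * (1 + ξ ^ 2) ^ (k + 1)) ∧
      (∀ τ ξ, |deriv (simQ O τ) ξ| ≤ (2 * K + C) * (1 + ξ ^ 2) ^ (k + 1)) ∧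
      (∀ τ ξ, |deriv (deriv (simQ O τ)) ξ| ≤ (2 * K + C) * (1 + ξ ^ 2) ^ (k + 1)) ∧
      (∀ τ, ContDiff ℝ 1 (simQ S τ)) ∧ (∀ τ ξ, |simQ S τ ξ| ≤ A) ∧
      (∀ τ ξ, |deriv (simQ S τ) ξ| ≤ (2 * K + C) * (1 + ξ ^ 2) ^ (k + 1)) ∧
      (∀ τ ξ, Qt τ ξ + (1 / 2 : ℝ) * deriv (fun ξ' => (ξ' + simQ S τ ξ') * simQ O τ ξ') ξ ≤ deriv (deriv (simQ O τ)) ξ) := by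
  -- the time derivative, with `L(0,1)` written as the slice derivative
  set Qt : ℝ → ℝ → ℝ := fun τ ξ => sig τ ^ 3 * Od (tim τ) (ξ * sig τ) (1, 0)
    - (1 / 2 : ℝ) * sig τ * O (tim τ) (ξ * sig τ) - (1 / 2 : ℝ) * ξ * sig τ ^ 2 * deriv (O (tim τ)) (ξ * sig τ) with hQt
  -- constants are non-negative (from the bounds at one point)
  have hK0 : 0 ≤ K := by
    have h := hOz (-1) (by norm_num) 0
    have h1 : 0 ≤ (-(-1:ℝ)) * |deriv (O (-1)) 0| := by positivity
    have h2 : (0:ℝ) < (1 + (0:ℝ) ^ 2 / (-(-1:ℝ))) ^ k := by positivity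
    nlinarith
  have hc0 : 0 ≤ C := hC
  -- regularity facts at time `tim τ`
  have hOd : ∀ τ, Differentiable ℝ (O (tim τ)) := fun τ => (hO2 _ (tim_neg τ)).differentiable (by norm_num)
  have hO1 : ∀ τ, ContDiff ℝ 1 (deriv (O (tim τ))) := fun τ => by
    have h2 : ContDiff ℝ (1 + 1) (O (tim τ)) := by rw [one_add_one_eq_two]; exact hO2 _ (tim_neg τ)
    exact h2.deriv'
  have hO2d : ∀ τ, Differentiable ℝ (deriv (O (tim τ))) := fun τ => (hO1 τ).differentiable (by norm_num)
  have hSd : ∀ τ, Differentiable ℝ (S (tim τ)) := fun τ => (hS1 _ (tim_neg τ)).differentiable (by norm_num)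
  have hslice : ∀ τ ξ, Od (tim τ) (ξ * sig τ) (0, 1) = deriv (O (tim τ)) (ξ * sig τ) :=
    fun τ ξ => ((deriv_slice_eq (hOF _ (tim_neg τ) (ξ * sig τ))).deriv).symm
  have hlin : ∀ τ, ContDiff ℝ 2 (fun ξ : ℝ => ξ * sig τ) := fun τ => contDiff_id.mul contDiff_const
  refine ⟨Qt, ?_, ?_, ?_, ?_, ?_, ?_, ?_, ?_, ?_, ?_, ?_, ?_⟩
  · -- `Q(τ,·) ∈ C²`
    intro τ
    show ContDiff ℝ 2 (fun ξ => sig τ * O (tim τ) (ξ * sig τ))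
    exact contDiff_const.mul ((hO2 _ (tim_neg τ)).comp (hlin τ))
  · -- time derivative
    intro τ ξ
    have h := hasDerivAt_simQ_time (hOF _ (tim_neg τ) (ξ * sig τ))
    rw [hslice] at h
    simpa [hQt] using h
  · -- continuity of `Qt(τ,·)`
    intro τ
    have h1 : Continuous fun ξ : ℝ => Od (tim τ) (ξ * sig τ) (1, 0) :=
      (hOtc _ (tim_neg τ)).comp (continuous_id.mul continuous_const)
    have h2 : Continuous fun ξ : ℝ => O (tim τ) (ξ * sig τ) := (hOd τ).continuous.comp (continuous_id.mul continuous_const)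
    have h3 : Continuous fun ξ : ℝ => deriv (O (tim τ)) (ξ * sig τ) :=
      (hO2d τ).continuous.comp (continuous_id.mul continuous_const)
    simp only [hQt]
    exact ((continuous_const.mul h1).sub (continuous_const.mul h2)).sub
      (((continuous_const.mul continuous_id).mul continuous_const).mul h3)
  · -- `0 ≤ Q`
    exact (simQ_nonneg_iff (O := O)).2 h0
  · -- `|Q| ≤ K′(1+ξ²)^{k+1}`
    intro τ ξ
    have h := hOb _ (tim_neg τ) (ξ * sig τ)
    rw [sqrt_neg_tim, sim_ratio] at h
    have hPk : (1 + ξ ^ 2) ^ k ≤ (1 + ξ ^ 2) ^ (k + 1) := pow_le_pow_right₀ (by nlinarith [sq_nonneg ξ]) (Nat.le_succ k)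
    have hq0 : 0 ≤ sig τ * O (tim τ) (ξ * sig τ) := mul_nonneg (sig_pos τ).le (h0 _ (tim_neg τ) _)
    show |sig τ * O (tim τ) (ξ * sig τ)| ≤ _
    rw [abs_of_nonneg hq0]
    nlinarith [mul_nonneg hc0 (sub_nonneg.2 hPk), mul_nonneg hK0 (pow_nonneg (show (0:ℝ) ≤ 1 + ξ ^ 2 by positivity) (k + 1))]
  · -- `|Qt| ≤ K′(1+ξ²)^{k+1}`
    intro τ ξ
    have ht := tim_neg τ
    have hσ := sig_pos τ
    have hP : (1 + (ξ * sig τ) ^ 2 / (-tim τ)) = 1 + ξ ^ 2 := sim_ratio τ ξ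
    have b1 : sig τ ^ 3 * |Od (tim τ) (ξ * sig τ) (1, 0)| ≤ K * (1 + ξ ^ 2) ^ k := by
      have h := hOt _ ht (ξ * sig τ)
      rw [sqrt_neg_tim, hP, ← sig_sq] at h
      calc sig τ ^ 3 * |Od (tim τ) (ξ * sig τ) (1, 0)| = sig τ * sig τ ^ 2 * |Od (tim τ) (ξ * sig τ) (1, 0)| := by ring
        _ ≤ K * (1 + ξ ^ 2) ^ k := h
    have b2 : sig τ * O (tim τ) (ξ * sig τ) ≤ C * (1 + ξ ^ 2) ^ k := by
      have h := hOb _ ht (ξ * sig τ); rwa [sqrt_neg_tim, hP] at h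
    have b2' : 0 ≤ sig τ * O (tim τ) (ξ * sig τ) := mul_nonneg hσ.le (h0 _ ht _)
    have b3 : sig τ ^ 2 * |deriv (O (tim τ)) (ξ * sig τ)| ≤ K * (1 + ξ ^ 2) ^ k := by
      have h := hOz _ ht (ξ * sig τ)
      rwa [hP, ← sig_sq] at h
    have hP1 : 1 ≤ (1 + ξ ^ 2) ^ k := one_le_pow₀ (by nlinarith [sq_nonneg ξ])
    have hPk : (1 + ξ ^ 2) ^ k ≤ (1 + ξ ^ 2) ^ (k + 1) := pow_le_pow_right₀ (by nlinarith [sq_nonneg ξ]) (Nat.le_succ k)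
    have hξ : |ξ| * (1 + ξ ^ 2) ^ k ≤ (1 + ξ ^ 2) ^ (k + 1) := by
      have hle : |ξ| ≤ 1 + ξ ^ 2 := by
        rcases le_or_gt |ξ| 1 with h | h
        · nlinarith [sq_nonneg ξ]
        · have : |ξ| ≤ ξ ^ 2 := by rw [← sq_abs]; nlinarith
          linarith
      calc |ξ| * (1 + ξ ^ 2) ^ k ≤ (1 + ξ ^ 2) * (1 + ξ ^ 2) ^ k :=
            mul_le_mul_of_nonneg_right hle (pow_nonneg (show (0:ℝ) ≤ 1 + ξ ^ 2 by positivity) k)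
        _ = (1 + ξ ^ 2) ^ (k + 1) := by ring
    have t1 : |sig τ ^ 3 * Od (tim τ) (ξ * sig τ) (1, 0)| ≤ K * (1 + ξ ^ 2) ^ k := by
      rw [abs_mul, abs_of_pos (pow_pos hσ 3)]; exact b1
    have t2 : |(1 / 2 : ℝ) * sig τ * O (tim τ) (ξ * sig τ)| ≤ C * (1 + ξ ^ 2) ^ k / 2 := by
      rw [mul_assoc, abs_mul, abs_of_pos (by norm_num : (0:ℝ) < 1 / 2), abs_of_nonneg b2']; linarith
    have t3 : |(1 / 2 : ℝ) * ξ * sig τ ^ 2 * deriv (O (tim τ)) (ξ * sig τ)| ≤ (1 / 2 : ℝ) * |ξ| * (K * (1 + ξ ^ 2) ^ k) := by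
      have e : (1 / 2 : ℝ) * ξ * sig τ ^ 2 * deriv (O (tim τ)) (ξ * sig τ) =
          ((1 / 2 : ℝ) * ξ) * (sig τ ^ 2 * deriv (O (tim τ)) (ξ * sig τ)) := by ring
      rw [e, abs_mul, abs_mul, abs_of_pos (by norm_num : (0:ℝ) < 1 / 2), abs_mul, abs_of_pos (pow_pos hσ 2)]
      exact mul_le_mul_of_nonneg_left b3 (by positivity)
    have tri : |Qt τ ξ| ≤ |sig τ ^ 3 * Od (tim τ) (ξ * sig τ) (1, 0)| + |(1 / 2 : ℝ) * sig τ * O (tim τ) (ξ * sig τ)|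
        + |(1 / 2 : ℝ) * ξ * sig τ ^ 2 * deriv (O (tim τ)) (ξ * sig τ)| := by
      simp only [hQt]
      exact (abs_sub _ _).trans (add_le_add (abs_sub _ _) le_rfl)
    calc |Qt τ ξ| ≤ _ := tri
      _ ≤ K * (1 + ξ ^ 2) ^ k + C * (1 + ξ ^ 2) ^ k / 2 + (1 / 2 : ℝ) * |ξ| * (K * (1 + ξ ^ 2) ^ k) := by linarith
      _ ≤ (2 * K + C) * (1 + ξ ^ 2) ^ (k + 1) := by
          nlinarith [mul_nonneg hK0 (sub_nonneg.2 hPk), mul_nonneg hc0 (sub_nonneg.2 hPk),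
            mul_nonneg hc0 (pow_nonneg (show (0:ℝ) ≤ 1 + ξ ^ 2 by positivity) k),
            mul_nonneg hK0 (sub_nonneg.2 hξ), mul_nonneg hK0 (pow_nonneg (show (0:ℝ) ≤ 1 + ξ ^ 2 by positivity) (k + 1)),
            abs_nonneg ξ, mul_nonneg (abs_nonneg ξ) (pow_nonneg (show (0:ℝ) ≤ 1 + ξ ^ 2 by positivity) k)]
  · -- `|Q_ξ| ≤ K′(1+ξ²)^{k+1}`
    intro τ ξ
    have ht := tim_neg τ
    rw [deriv_simQ_xi (hOd τ)]
    have h := hOz _ ht (ξ * sig τ)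
    rw [sim_ratio, ← sig_sq] at h
    have hPk : (1 + ξ ^ 2) ^ k ≤ (1 + ξ ^ 2) ^ (k + 1) := pow_le_pow_right₀ (by nlinarith [sq_nonneg ξ]) (Nat.le_succ k)
    rw [abs_mul, abs_of_pos (pow_pos (sig_pos τ) 2)]
    nlinarith [mul_nonneg hK0 (sub_nonneg.2 hPk), mul_nonneg hc0 (pow_nonneg (show (0:ℝ) ≤ 1 + ξ ^ 2 by positivity) (k + 1)),
      mul_nonneg hK0 (pow_nonneg (show (0:ℝ) ≤ 1 + ξ ^ 2 by positivity) (k + 1))]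
  · -- `|Q_ξξ| ≤ K′(1+ξ²)^{k+1}`
    intro τ ξ
    have ht := tim_neg τ
    rw [deriv_deriv_simQ_xi (hOd τ) (hO2d τ)]
    have h := hOzz _ ht (ξ * sig τ)
    rw [sqrt_neg_tim, sim_ratio, ← sig_sq] at h
    have hPk : (1 + ξ ^ 2) ^ k ≤ (1 + ξ ^ 2) ^ (k + 1) := pow_le_pow_right₀ (by nlinarith [sq_nonneg ξ]) (Nat.le_succ k)
    rw [abs_mul, abs_of_pos (pow_pos (sig_pos τ) 3)]
    have e : sig τ ^ 3 = sig τ * sig τ ^ 2 := by ring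
    rw [e]
    nlinarith [mul_nonneg hK0 (sub_nonneg.2 hPk), mul_nonneg hc0 (pow_nonneg (show (0:ℝ) ≤ 1 + ξ ^ 2 by positivity) (k + 1)),
      mul_nonneg hK0 (pow_nonneg (show (0:ℝ) ≤ 1 + ξ ^ 2 by positivity) (k + 1))]
  · -- `Ŝ(τ,·) ∈ C¹`
    intro τ
    show ContDiff ℝ 1 (fun ξ => sig τ * S (tim τ) (ξ * sig τ))
    exact contDiff_const.mul ((hS1 _ (tim_neg τ)).comp ((hlin τ).of_le (by norm_num)))
  · -- `|Ŝ| ≤ A`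
    intro τ ξ
    have h := hSA _ (tim_neg τ) (ξ * sig τ)
    rw [sqrt_neg_tim] at h
    show |sig τ * S (tim τ) (ξ * sig τ)| ≤ A
    rwa [abs_mul, abs_of_pos (sig_pos τ)]
  · -- `|Ŝ_ξ| ≤ K′(1+ξ²)^{k+1}`
    intro τ ξ
    have ht := tim_neg τ
    rw [deriv_simQ_xi (hSd τ)]
    have h := hSz _ ht (ξ * sig τ)
    rw [sim_ratio, ← sig_sq] at h
    have hPk : (1 + ξ ^ 2) ^ k ≤ (1 + ξ ^ 2) ^ (k + 1) := pow_le_pow_right₀ (by nlinarith [sq_nonneg ξ]) (Nat.le_succ k)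
    rw [abs_mul, abs_of_pos (pow_pos (sig_pos τ) 2)]
    nlinarith [mul_nonneg hK0 (sub_nonneg.2 hPk), mul_nonneg hc0 (pow_nonneg (show (0:ℝ) ≤ 1 + ξ ^ 2 by positivity) (k + 1)),
      mul_nonneg hK0 (pow_nonneg (show (0:ℝ) ≤ 1 + ξ ^ 2 by positivity) (k + 1))]
  · -- the similarity form of (OSC)
    intro τ ξ
    have hO2all : ∀ t < 0, Differentiable ℝ (deriv (O t)) := fun t ht => by
      have h2 : ContDiff ℝ (1 + 1) (O t) := by rw [one_add_one_eq_two]; exact hO2 t ht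
      exact h2.deriv'.differentiable (by norm_num)
    have hSall : ∀ t < 0, Differentiable ℝ (S t) := fun t ht => (hS1 t ht).differentiable (by norm_num)
    have h := sim_subsolution_of_osc (S := S) hOF hO2all hSall hosc τ ξ
    rw [hslice] at h
    simpa [hQt] using h

end Summit.NavierStokesRegularity.NavierStokesRegularity.Theorems.PoloidalWindowDoorLrcModEntireTwistingTHOscSimilarityObject
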